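import Mathlib
import Summits.KontsevichZagierPeriods.Zeta5Search.BrickBallApery

/-!
# BrickSupercongruencePowers — THEOREM 10 at the natural level `L = ⌊log_p n⌋` and along prime powers:
`β_s(n·p^r) ≡ β_s(n) (mod p³)`; instances for Zudilin's `u_n` and the Apéry sequences (cell zeta5-irr)

HONEST FRAMING: systematic search; no irrationality claim unless certified. INSTRUMENT corollaries of the ζ(5) census
cell zeta5-irr (HOME `run/shared/lean/pub/zeta5-irr/`): bookkeeping consequences of `BrickTheoremTen.theoremTen` (zi-p2's
T-B8.6, sealed `zi-p2/probes/B8/thm10/THEOREM10.md` (viii): «Equivalently β_s(mp^r) ≡ β_s(mp^{r−1}) (mod p³) for every m, r ≥ 1»)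
and of the identifications of `BrickLinearForms` / `BrickBallApery`. Nothing here is about ζ(5); 0 nats/n; rung F-Z1 NOT moved.
Filed by the engine seat zi-eng (g11). No new definitions.

## What is PROVED (p ≥ 5 prime, `A` even, `3 ≤ A`, `1 ≤ B`, `2B ≤ A`; `τ_s = A−1−s`; `v = Rat.padicValuation p`, `v(x) ≤ exp(−3)` ⟺
`x = 0 ∨ ord_p x ≥ 3`)

* `theoremTen_log` — (S) for EVERY `n` at its own level `L = Nat.log p n` (`p^L ≤ n < p^{L+1}` for `n ≥ 1`);
* **`theoremTen_pow`** — along prime powers: for `n < p^{L+1}` and every `r`,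
  `v(p^{(L+r)τ_s}x_s(n·p^r) − p^{Lτ_s}x_s(n)) ≤ exp(−3)` for all cells `s+1 ≤ A` and the harmonic cell (ultrametric chaining);
* instances on printed objects: `uC_congr_pow` (`u_{np^r} ≡ u_n (mod p³)`, Zudilin 2002's `ζ(5)`-coefficients, every `n, r`),
  `aperyNumber_modEq_mul_prime_pow` (`b_{np^r} ≡ b_n (mod p³)`, Apéry numbers), `pT_congr_pow`
  (`p^{3(L+r)}a_{np^r} ≡ p^{3L}a_n (mod p³)`, Apéry's second sequence, `n < p^{L+1}`).

WHAT THIS IS NOT: not the stronger two-term supercongruences `mod p^{3r}` of Beukers 1985 / Coster 1988 for the Apéry numbers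
(the brick chain proves `mod p³` only; `mod p⁴` is false in general for (S), zi-p2 TB86-SUMMARY §1).
-/

namespace Summit.KontsevichZagierPeriods.Zeta5Search.BrickSupercongruencePowers

open Finset Nat WithZero
open Literature.NumberTheory.Transcendental.Apery (pT)
open Literature.NumberTheory.Irrationality.Zudilin2002 (uC)
open Literature.Combinatorics.Enumerative.AperyNumbers (aperyNumber)
open Summit.KontsevichZagierPeriods.Zeta5Search.BrickPartialFractions (xCoeff xZero)
open Summit.KontsevichZagierPeriods.Zeta5Search.BrickTheoremTen (theoremTen)
open Summit.KontsevichZagierPeriods.Zeta5Search.BrickLinearForms (uC_eq_xCoeff)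
open Summit.KontsevichZagierPeriods.Zeta5Search.BrickBallApery (xCoeff_three_eq_aperyNumber xZero_eq_neg_pT
  padicValuation_intCast_le_exp_neg_iff)

noncomputable section

variable {p : ℕ} [hp : Fact p.Prime]

section general

variable (h3 : 3 < p) {A B : ℕ} (hA : Even A) (hB : 1 ≤ B) (hAB : 2 * B ≤ A) (hA3 : 3 ≤ A)
include h3 hA hB hAB hA3

/-- **(S) at the natural level.** For every `n`, with `L = ⌊log_p n⌋` (`Nat.log p n`; so `n < p^{L+1}` always and `p^L ≤ n`
for `n ≥ 1`): `v(p^{(L+1)τ_s}x_s(np) − p^{Lτ_s}x_s(n)) ≤ exp(−3)` for every cell `s+1 ≤ A` and for the harmonic cell. -/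
theorem theoremTen_log (n : ℕ) :
    (∀ s, s + 1 ≤ A → Rat.padicValuation p ((p : ℚ) ^ ((Nat.log p n + 1) * (A - 1 - s)) * xCoeff A B 1 (n * p) s -
        (p : ℚ) ^ (Nat.log p n * (A - 1 - s)) * xCoeff A B 1 n s) ≤ exp (-3)) ∧
      Rat.padicValuation p ((p : ℚ) ^ ((Nat.log p n + 1) * (A - 1)) * xZero A B 1 (n * p) -
        (p : ℚ) ^ (Nat.log p n * (A - 1)) * xZero A B 1 n) ≤ exp (-3) :=
  theoremTen h3 hA hB hAB hA3 (Nat.lt_pow_succ_log_self hp.out.one_lt n)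

/-- **(S) along prime powers**: for `n < p^{L+1}` and every `r`,
`v(p^{(L+r)τ_s}x_s(n·p^r) − p^{Lτ_s}x_s(n)) ≤ exp(−3)` (all cells `s+1 ≤ A`) and the same for `x_0` with `τ_0 = A−1` — i.e.
`β_s(np^r) ≡ β_s(np^{r−1}) ≡ … ≡ β_s(n) (mod p³)` (THEOREM10.md (viii) «equivalently»), by `r` applications of `theoremTen`
and the ultrametric inequality. -/
theorem theoremTen_pow {L n : ℕ} (hn : n < p ^ (L + 1)) (r : ℕ) :
    (∀ s, s + 1 ≤ A → Rat.padicValuation p ((p : ℚ) ^ ((L + r) * (A - 1 - s)) * xCoeff A B 1 (n * p ^ r) s -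
        (p : ℚ) ^ (L * (A - 1 - s)) * xCoeff A B 1 n s) ≤ exp (-3)) ∧
      Rat.padicValuation p ((p : ℚ) ^ ((L + r) * (A - 1)) * xZero A B 1 (n * p ^ r) -
        (p : ℚ) ^ (L * (A - 1)) * xZero A B 1 n) ≤ exp (-3) := by
  induction r with
  | zero =>
    refine ⟨fun s _ => ?_, ?_⟩ <;> simp
  | succ r ih =>
    have hm : n * p ^ r < p ^ (L + r + 1) := by
      calc n * p ^ r < p ^ (L + 1) * p ^ r := Nat.mul_lt_mul_of_pos_right hn (pow_pos hp.out.pos r)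
        _ = p ^ (L + r + 1) := by rw [← pow_add]; ring_nf
    have h := theoremTen h3 hA hB hAB hA3 hm
    have hmul : n * p ^ (r + 1) = n * p ^ r * p := by ring
    refine ⟨fun s hs => ?_, ?_⟩
    · have h1 := h.1 s hs
      have h2 := ih.1 s hs
      rw [hmul, show L + (r + 1) = L + r + 1 by ring]
      have key := Valuation.map_add_le (Rat.padicValuation p) h1 h2
      rwa [sub_add_sub_cancel] at key
    · have h1 := h.2
      have h2 := ih.2
      rw [hmul, show L + (r + 1) = L + r + 1 by ring]
      have key := Valuation.map_add_le (Rat.padicValuation p) h1 h2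
      rwa [sub_add_sub_cancel] at key

end general

/-! ## Instances on printed objects -/

/-- **`u_{np^r} ≡ u_n (mod p³)`** for the `ζ(5)`-coefficients `u_n` of Zudilin's `r_n` (2002, eq. (7); kernel `(6,1,1)`, cell
`s = 5`, `τ_5 = 0`), every `n`, `r`, prime `p ≥ 5`. -/
theorem uC_congr_pow (h3 : 3 < p) (n r : ℕ) : Rat.padicValuation p (uC (n * p ^ r) - uC n) ≤ exp (-3) := by
  have hn : n < p ^ (n + 1) :=
    calc n < 2 ^ n := Nat.lt_two_pow_self
      _ ≤ p ^ n := Nat.pow_le_pow_left hp.out.two_le n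
      _ ≤ p ^ (n + 1) := Nat.pow_le_pow_right hp.out.pos (by omega)
  have h := (theoremTen_pow (A := 6) (B := 1) h3 ⟨3, rfl⟩ le_rfl (by norm_num) (by norm_num) hn r).1 5 (by norm_num)
  simpa only [uC_eq_xCoeff, show 6 - 1 - 5 = 0 from rfl, mul_zero, pow_zero, one_mul] using h

/-- **`b_{np^r} ≡ b_n (mod p³)`** for the Apéry numbers `b_n = Σ_k C(n,k)²C(n+k,k)²`, every `n`, `r`, prime `p ≥ 5` — the cell
`s = 3` of the Ball kernel `(4,1,1)` along prime powers (also immediate from Gessel's theorem by iteration; here from THEOREM 10). -/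
theorem aperyNumber_modEq_mul_prime_pow (h3 : 3 < p) (n r : ℕ) :
    ((aperyNumber (n * p ^ r) : ℕ) : ℤ) ≡ (aperyNumber n : ℕ) [ZMOD (p : ℤ) ^ 3] := by
  have hn : n < p ^ (n + 1) :=
    calc n < 2 ^ n := Nat.lt_two_pow_self
      _ ≤ p ^ n := Nat.pow_le_pow_left hp.out.two_le n
      _ ≤ p ^ (n + 1) := Nat.pow_le_pow_right hp.out.pos (by omega)
  have h := (theoremTen_pow (A := 4) (B := 1) h3 ⟨2, rfl⟩ le_rfl (by norm_num) (by norm_num) hn r).1 3 (by norm_num)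
  simp only [show 4 - 1 - 3 = 0 from rfl, mul_zero, pow_zero, one_mul] at h
  rw [xCoeff_three_eq_aperyNumber, xCoeff_three_eq_aperyNumber, ← Int.cast_natCast,
    ← Int.cast_natCast (aperyNumber n), ← Int.cast_sub, show (-3 : ℤ) = -((3 : ℕ) : ℤ) by norm_num,
    padicValuation_intCast_le_exp_neg_iff] at h
  exact (Int.modEq_iff_dvd.2 h).symm

/-- **`p^{3(L+r)}a_{np^r} ≡ p^{3L}a_n (mod p³)`** for Apéry's second sequence `a_n = p_{n,n}` (`n < p^{L+1}`, every `r`,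
prime `p ≥ 5`) — the harmonic cell of the Ball kernel along prime powers. -/
theorem pT_congr_pow (h3 : 3 < p) {L n : ℕ} (hn : n < p ^ (L + 1)) (r : ℕ) :
    Rat.padicValuation p ((p : ℚ) ^ (3 * (L + r)) * pT (n * p ^ r) (n * p ^ r) - (p : ℚ) ^ (3 * L) * pT n n) ≤
      exp (-3) := by
  have h := (theoremTen_pow (A := 4) (B := 1) h3 ⟨2, rfl⟩ le_rfl (by norm_num) (by norm_num) hn r).2
  rw [xZero_eq_neg_pT, xZero_eq_neg_pT, mul_neg, mul_neg, neg_sub_neg, Valuation.map_sub_swap,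
    mul_comm (L + r) (4 - 1), mul_comm L (4 - 1)] at h
  exact h

end

end Summit.KontsevichZagierPeriods.Zeta5Search.BrickSupercongruencePowers
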